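import Summits.Ventures.Crystal3D.Theorems.StickyWulffConstantGenericWallFloorHRowWalk
import Summits.Ventures.Crystal3D.Theorems.StickyWulffConstantGenericWallFloorStackWalkInv
import Summits.Ventures.Crystal3D.Theorems.StickyWulffConstantTextureLiminfTexShadowFluxPairSteerCore
import HarnessLib

/-!
# (J-a): at an h-row END ball NO bottom-level row state of the stack walk is certified
# (crux `GenericWallFloor`, stmt-Ventures-19480, kernel G; line «LAYER ROWS», cf-p1 RULING (ccxi)(A): (J) = the one open lemma inside R1 — this is its
#  bottom-level half; 19480-p2 g13)

HONEST FRAMING. Venture `Summits/Ventures/Crystal3D` (cell `crystal3d-full`), route `route-Ventures-StickyWulffConstant`, helper for the crux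
`GenericWallFloor` (stmt-Ventures-19480) / consumer `TextureLiminfV5` (stmt-Ventures-23912).  Elementary slot geometry; standard axioms; F-C1 not moved.

THE POINT.  LAYER ROWS runs c-rows (the stack walk with in-plane steep bottom ⟨F, u, 0⟩, `F ∈ {L₁, G₁}`) and h-rows (`hRowStep`) as ONE family; the
joint per-ball count needs (J): «no c-row walker ENDS at an h-row END ball».  A c-walker standing at `y` with its BOTTOM entry on top (frame `F`,
direction `u`) has predecessor `p = y − F u` and is `WalkCertified`: `p` is `F`-FULL or an exact `F`-cap ORIENTED along `u`.  If `y` is the end ball of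
the h-row through `p` then `p` is h-FULL (`p + F·hcpSlots ⊆ X`), and both alternatives die on ONE distance: a lower slot `−t` of `F` and the basal
mirror `M t'` of ANOTHER upper slot lie `1/√3` apart (`dist_neg_upSlot_mirror_upSlot`), so they are never both occupied in a `1`-separated `X`:
* `F`-full puts `p + F(−upSlot₂)` next to the occupied `p + F(M upSlot₁)`;
* an `F`-cap along `u` has exactly three positive slots (`card_far_slots_eq_three`), `u` among them, so some upper slot `t₀` is non-positive, its
  opposite `−t₀` is a non-negative slot, hence occupied — next to the occupied `p + F(M t')`, `t' ≠ t₀`.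
* **`not_walkCertified_bottom_of_hFull`** — `¬ WalkCertified X y e` for every entry `e` with `e.frame = F`, `e.dir = u`.
So only PUSHED-level states (top frame an inclined chain frame) remain for (J) — (J-b), evidence: owner's enumeration to depth 5 (kit j330741) and
200k random frames (j330576/j330591): no feasible arrival can rise.
WHAT THIS IS NOT: not (J-b); no count; F-C1 not moved.
-/

noncomputable section

namespace Summit.Ventures.Crystal3D.Theorems

open Finset
open Literature.MathematicalPhysics.StatisticalMechanics (barlowPos_apply_two basalMirror basalMirror_apply_coord)
open Summit.Ventures.Crystal3D.Cruxes.TextureLiminf.TexShadow (upSlot₁ upSlot₂ upSlot₃ inner_upSlot_upSlot upSlots_ne)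
open scoped InnerProductSpace

variable {X : Finset (EuclideanSpace ℝ (Fin 3))}

/-! ### One distance -/

/-- The inner product in coordinates. -/
private theorem inner_three' (x y : EuclideanSpace ℝ (Fin 3)) : ⟪x, y⟫_ℝ = x 0 * y 0 + x 1 * y 1 + x 2 * y 2 := by
  simp [PiLp.inner_apply, Fin.sum_univ_three, mul_comm]

/-- `⟪w, M t⟫ = ⟪w, t⟫ − 2 w₂ t₂` for the basal mirror `M`. -/
private theorem inner_mirror_right' (w t : EuclideanSpace ℝ (Fin 3)) : ⟪w, basalMirror t⟫_ℝ = ⟪w, t⟫_ℝ - 2 * w 2 * t 2 := by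
  rw [inner_three', inner_three', basalMirror_apply_coord, basalMirror_apply_coord, basalMirror_apply_coord]
  simp; ring

/-- The three upper slots: membership, height, unit norm. -/
private theorem upSlot_facts {t : EuclideanSpace ℝ (Fin 3)} (ht : t = upSlot₁ ∨ t = upSlot₂ ∨ t = upSlot₃) :
    t ∈ fccSlots ∧ t 2 = Real.sqrt (2 / 3) ∧ ‖t‖ = 1 := by
  obtain ⟨h1, h2, h3⟩ := upSlots_mem_fccSlots
  rcases ht with rfl | rfl | rfl
  · exact ⟨h1, by simp [upSlot₁, barlowPos_apply_two], norm_eq_one_of_mem_fccSlots h1⟩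
  · exact ⟨h2, by simp [upSlot₂, barlowPos_apply_two], norm_eq_one_of_mem_fccSlots h2⟩
  · exact ⟨h3, by simp [upSlot₃, barlowPos_apply_two], norm_eq_one_of_mem_fccSlots h3⟩

/-- **A lower slot and the mirror of ANOTHER upper slot are `1/√3` apart**: for distinct upper slots `t, t'` and any frame `F`,
`dist (F (−t)) (F (M t')) < 1` and the two points differ. -/
theorem dist_neg_upSlot_mirror_upSlot (F : EuclideanSpace ℝ (Fin 3) ≃ₗᵢ[ℝ] EuclideanSpace ℝ (Fin 3))
    {t t' : EuclideanSpace ℝ (Fin 3)} (ht : t = upSlot₁ ∨ t = upSlot₂ ∨ t = upSlot₃) (ht' : t' = upSlot₁ ∨ t' = upSlot₂ ∨ t' = upSlot₃)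
    (hne : t ≠ t') : F (-t) ≠ F (basalMirror t') ∧ dist (F (-t)) (F (basalMirror t')) < 1 := by
  obtain ⟨-, ht2, htn⟩ := upSlot_facts ht
  obtain ⟨-, ht'2, ht'n⟩ := upSlot_facts ht'
  have h23 : Real.sqrt (2 / 3) * Real.sqrt (2 / 3) = 2 / 3 := Real.mul_self_sqrt (by norm_num)
  have hinner : ⟪t, t'⟫_ℝ = 1 / 2 := by rw [inner_upSlot_upSlot ht ht', if_neg hne]
  have hsq : dist (F (-t)) (F (basalMirror t')) ^ 2 = 1 / 3 := by
    have h43 : 2 * Real.sqrt (2 / 3) * Real.sqrt (2 / 3) = 4 / 3 := by rw [mul_assoc, h23]; norm_num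
    rw [dist_eq_norm, ← map_sub, LinearIsometryEquiv.norm_map, show -t - basalMirror t' = -(t + basalMirror t') by abel, norm_neg,
      norm_add_sq_real, inner_mirror_right', LinearIsometryEquiv.norm_map, htn, ht'n, hinner, ht2, ht'2]
    linarith
  have hd0 : 0 ≤ dist (F (-t)) (F (basalMirror t')) := dist_nonneg
  constructor
  · intro h
    rw [← dist_eq_zero] at h
    rw [h] at hsq; norm_num at hsq
  · nlinarith

/-! ### No bottom-level state at an h-row end -/

/-- **(J-a): a bottom-level row state is NOT certified at an h-row END ball.**  `X` `1`-separated; `u` an in-plane slot; the predecessor `y − F u` h-FULL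
(`y − F u + F·hcpSlots ⊆ X`); then no walk entry with frame `F` and direction `u` is `WalkCertified` at `y`. -/
theorem not_walkCertified_bottom_of_hFull (hX : ∀ p ∈ X, ∀ q ∈ X, p ≠ q → 1 ≤ dist p q)
    {F : EuclideanSpace ℝ (Fin 3) ≃ₗᵢ[ℝ] EuclideanSpace ℝ (Fin 3)} {u : EuclideanSpace ℝ (Fin 3)} (hu : u ∈ fccSlots) (hu2 : u 2 = 0)
    {y : EuclideanSpace ℝ (Fin 3)} (hfull : ∀ s ∈ hcpSlots, y - F u + F s ∈ X)
    {e : WalkEntry} (hframe : e.frame = F) (hdir : e.dir = u) : ¬ WalkCertified X y e := by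
  classical
  obtain ⟨hm1, hm2, hm3⟩ := upSlots_mem_fccSlots
  obtain ⟨n12, n13, n23⟩ := upSlots_ne
  have hc : 0 < Real.sqrt (2 / 3) := Real.sqrt_pos.2 (by norm_num)
  -- the mirrored upper slots are occupied
  have hM : ∀ {t' : EuclideanSpace ℝ (Fin 3)}, (t' = upSlot₁ ∨ t' = upSlot₂ ∨ t' = upSlot₃) → y - F u + F (basalMirror t') ∈ X := by
    intro t' ht'
    obtain ⟨hf, h2, -⟩ := upSlot_facts ht'
    exact hfull _ (basalMirror_mem_hcpSlots_of_upper hf (by rw [h2]; exact hc.le))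
  -- the clash: an occupied lower slot `−t` against an occupied mirror `M t'`, `t ≠ t'`
  have clash : ∀ {t t' : EuclideanSpace ℝ (Fin 3)}, (t = upSlot₁ ∨ t = upSlot₂ ∨ t = upSlot₃) → (t' = upSlot₁ ∨ t' = upSlot₂ ∨ t' = upSlot₃) →
      t ≠ t' → y - F u + F (-t) ∈ X → False := by
    intro t t' ht ht' hne hocc
    obtain ⟨hne', hlt⟩ := dist_neg_upSlot_mirror_upSlot F ht ht' hne
    have h1 := hX _ hocc _ (hM ht') (fun h => hne' (add_left_cancel h))
    rw [dist_eq_norm, add_sub_add_left_eq_sub, ← dist_eq_norm] at h1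
    linarith
  rintro (⟨-, hall⟩ | ⟨n₀, hn₀, hmenu, hpos, -, hocc⟩)
  · -- FULL: the lower slot `−upSlot₂` is occupied, next to `M upSlot₁`
    rw [hframe, hdir] at hall
    exact clash (Or.inr (Or.inl rfl)) (Or.inl rfl) (Ne.symm n12) (hall _ (neg_mem_fccSlots hm2))
  · -- CAP along `u`: three positive slots, `u` among them, so some upper slot is non-positive
    rw [hframe] at hmenu hocc
    rw [hframe, hdir] at hpos
    have h3 := card_far_slots_eq_three F hn₀ hmenu
    have hex : ∃ t, (t = upSlot₁ ∨ t = upSlot₂ ∨ t = upSlot₃) ∧ ⟪F t, n₀⟫_ℝ ≤ 0 := by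
      by_contra hno
      push Not at hno
      have hp1 := hno upSlot₁ (Or.inl rfl)
      have hp2 := hno upSlot₂ (Or.inr (Or.inl rfl))
      have hp3 := hno upSlot₃ (Or.inr (Or.inr rfl))
      -- `{u, upSlot₁, upSlot₂, upSlot₃}` are four distinct positive slots
      have hu1 : u ≠ upSlot₁ := fun h => by
        have := (upSlot_facts (Or.inl rfl)).2.1; rw [← h, hu2] at this; exact hc.ne' this.symm
      have hu2' : u ≠ upSlot₂ := fun h => by
        have := (upSlot_facts (Or.inr (Or.inl rfl))).2.1; rw [← h, hu2] at this; exact hc.ne' this.symm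
      have hu3 : u ≠ upSlot₃ := fun h => by
        have := (upSlot_facts (Or.inr (Or.inr rfl))).2.1; rw [← h, hu2] at this; exact hc.ne' this.symm
      have hsub : ({u, upSlot₁, upSlot₂, upSlot₃} : Finset (EuclideanSpace ℝ (Fin 3))) ⊆ fccSlots.filter fun w => 0 < ⟪F w, n₀⟫_ℝ := by
        intro w hw
        simp only [mem_insert, mem_singleton] at hw
        rw [mem_filter]
        rcases hw with rfl | rfl | rfl | rfl
        · exact ⟨hu, hpos⟩
        · exact ⟨hm1, hp1⟩
        · exact ⟨hm2, hp2⟩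
        · exact ⟨hm3, hp3⟩
      have hcard4 : ({u, upSlot₁, upSlot₂, upSlot₃} : Finset (EuclideanSpace ℝ (Fin 3))).card = 4 := by
        rw [card_insert_of_notMem (by simp [hu1, hu2', hu3]), card_insert_of_notMem (by simp [n12, n13]),
          card_insert_of_notMem (by simp [n23]), card_singleton]
      have := card_le_card hsub
      rw [hcard4, h3] at this
      omega
    obtain ⟨t₀, ht₀, hle⟩ := hex
    obtain ⟨ht₀S, -, -⟩ := upSlot_facts ht₀
    have hocc₀ : y - F u + F (-t₀) ∈ X := by
      have := hocc (-t₀) (neg_mem_fccSlots ht₀S) (by rw [map_neg, inner_neg_left]; linarith)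
      rwa [hdir] at this
    -- pick another upper slot
    rcases ht₀ with rfl | rfl | rfl
    · exact clash (Or.inl rfl) (Or.inr (Or.inl rfl)) n12 hocc₀
    · exact clash (Or.inr (Or.inl rfl)) (Or.inl rfl) (Ne.symm n12) hocc₀
    · exact clash (Or.inr (Or.inr rfl)) (Or.inl rfl) (Ne.symm n13) hocc₀

end Summit.Ventures.Crystal3D.Theorems

end
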